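import Summits.AtomisticToContinuum.BoseEinsteinCondensation.Theses.BECModePrice
import Summits.AtomisticToContinuum.BoseEinsteinCondensation.Theorems.BECModePriceModePriceHardCoreStubUniformTowerOfScaleFree
import Summits.AtomisticToContinuum.BoseEinsteinCondensation.Theorems.BECModePriceModePriceHardCoreStubUniformTowerOfModePrice
import Summits.AtomisticToContinuum.BoseEinsteinCondensation.Theorems.BECConjugateDominationHardCoreExtensionTruncationEnergyConvergenceAll
import Literature.MathematicalPhysics.QuantumManyBody.PeriodicBoseGasFracEnergy
import Literature.MathematicalPhysics.QuantumManyBody.PeriodicKineticBudget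
import Literature.MathematicalPhysics.QuantumManyBody.BoseGasDirichletWall
import Literature.Barriers.AtomisticToContinuum.KineticGapLengthScalesThermodynamicWindow
import HarnessLib

/-!
# The tower shadow of the single-mode softening price: `ModePriceHardCore` ⟺ height-uniform SMS along `min(v,n)`,
# and `ModePriceHardCore` ⟸ scale-free integrable SMS
# (crux `BECModePrice.ModePriceHardCore`, stmt-AtomisticToContinuum-18513 — line `IdeatorSketchK1` / idea `tower-shadow`, lead cycle 1)

The crux `ModePriceHardCore` is the single-mode-softening (SMS) inequality for the NON-integrable repulsive finite-range
potentials (`∫ v = ⊤`: hard cores, strongly singular cores): `∃ C ρ₀, ∀ ρ ∈ (0,ρ₀), ∀ᶠ N, ∀ p ≠ 0, ∀ Ψ,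
E₀^per(v; N, L_N) + ½|2πp/L_N|² n_p(Ψ) ≤ ⟨Ψ, H_v Ψ⟩ + Cρ` (`L_N = (N/ρ)^{1/3}`).

This file proves, with no `sorry` and no new definition:

* `modePriceAt_of_towerSMS` — the SHADOW STEP at fixed volume: SMS for all high levels `min(v,n)` with a common constant
  implies SMS for `v` with the same constant (`periodicEnergy_mono_of_le` + the landed fixed-volume energy convergence
  `stub_truncationEnergyConvergenceAll` + `ENNReal.le_of_forall_pos_le_add`);
* `stub_smsHardCore_of_towerSMS` — height-uniform tower SMS (for the non-integrable `v`) ⇒ the crux body (Ruelle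
  finiteness `exists_eventually_periodicGroundStateEnergy_lt_top` discharges `E₀ < ⊤`);
* `sms_iff_towerSMS` — PER POTENTIAL, for every admissible `v`: SMS(v) ⟺ tower SMS(v) (`→` is the landed necessity stub
  `stub_uniformTower_of_modePrice`: Rellich + Fatou up the tower + hard-core max-form `C¹` approximation + `n_p` Lipschitz);
* `towerSMS_iff_modePriceHardCore` — the line's residue is EQUIVALENT to the crux;
* `modePriceHardCore_of_scaleFree` — the crux follows from SMS for INTEGRABLE finite-range potentials with constants
  depending on the range bound only (the landed instantiation stub `stub_uniformTower_of_scaleFree`): the hard-core crux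
  is a renormalisation audit of the integrable crux `ModePriceIntegrable` (stmt-18512).

References: E. H. Lieb, R. Seiringer, J. P. Solovej, J. Yngvason, *The Mathematics of the Bose Gas and its Condensation*
(2005), §1.2 (1.17)–(1.18), Ch. 2 p. 14 (hard cores in the standing class); M. Reed, B. Simon, *Methods of Modern
Mathematical Physics IV* (1978), Thm XIII.64; B. Simon, J. Operator Theory 1 (1979) 37–47 (monotone convergence of forms).
-/

noncomputable section

namespace Summit.AtomisticToContinuum.BoseEinsteinCondensation.Cruxes.ModePriceHardCore.TowerShadow

open MeasureTheory Filter
open scoped ENNReal NNReal Topology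
open Literature.MathematicalPhysics.QuantumManyBody.BoseGas
open Summit.AtomisticToContinuum.BoseEinsteinCondensation.Theses.BECModePrice

/-! ## The shadow step (fixed volume) -/

/-- **Shadow step (fixed volume).** At fixed `(N, L, p)` with `0 < L` and `E₀^per(v; N, L) < ⊤`: if for all levels
`n ≥ n₀` every periodic trial state satisfies `E₀(min(v,n)) + ½|k_p|² n_p(Ψ) ≤ E_{min(v,n)}(Ψ) + B`, then
`E₀(v) + ½|k_p|² n_p(Ψ) ≤ E_v(Ψ) + B` — SMS is one-sided monotone in the potential at a fixed trial state and
`E₀(min(v,n)) ↑ E₀(v)` at fixed volume. [cite: ReedSimonIV1978, Thm XIII.64] -/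
theorem modePriceAt_of_towerSMS {v : ℝ → ℝ≥0∞} (hv : IsRepulsiveFiniteRange v) {N : ℕ} {L : ℝ} (hL : 0 < L)
    (hE : periodicGroundStateEnergy v N L ≠ ⊤) (p : Fin 3 → ℤ) (B : ℝ≥0∞) {n₀ : ℕ}
    (h : ∀ n : ℕ, n₀ ≤ n → ∀ Ψ : PeriodicTrialState N L,
      periodicGroundStateEnergy (fun r => min (v r) (n : ℝ≥0∞)) N L
          + 2⁻¹ * fracDispersion 2 L p * cellOccupation N L (planeWaveMode L p) Ψ.ψ
        ≤ periodicEnergy (fun r => min (v r) (n : ℝ≥0∞)) Ψ + B)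
    (Ψ : PeriodicTrialState N L) :
    periodicGroundStateEnergy v N L + 2⁻¹ * fracDispersion 2 L p * cellOccupation N L (planeWaveMode L p) Ψ.ψ
      ≤ periodicEnergy v Ψ + B := by
  refine ENNReal.le_of_forall_pos_le_add fun ε hε _ => ?_
  obtain ⟨n₁, hn₁⟩ :=
    Cruxes.HardCoreExtension.ThirdLawCurrentFloorAlt.stub_truncationEnergyConvergenceAll v hv N L hL hE ε
      (NNReal.coe_pos.mpr hε)
  have h1 := hn₁ (max n₀ n₁) (le_max_right _ _)
  have h2 := h (max n₀ n₁) (le_max_left _ _) Ψ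
  have h3 : periodicEnergy (fun r => min (v r) ((max n₀ n₁ : ℕ) : ℝ≥0∞)) Ψ ≤ periodicEnergy v Ψ :=
    periodicEnergy_mono_of_le (fun r => min_le_left _ _) Ψ
  have hεeq : ENNReal.ofReal (ε : ℝ) = (ε : ℝ≥0∞) := ENNReal.ofReal_coe_nnreal
  calc periodicGroundStateEnergy v N L + 2⁻¹ * fracDispersion 2 L p * cellOccupation N L (planeWaveMode L p) Ψ.ψ
      ≤ (periodicGroundStateEnergy (fun r => min (v r) ((max n₀ n₁ : ℕ) : ℝ≥0∞)) N L + ENNReal.ofReal ε)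
        + 2⁻¹ * fracDispersion 2 L p * cellOccupation N L (planeWaveMode L p) Ψ.ψ := add_le_add h1 le_rfl
    _ = (periodicGroundStateEnergy (fun r => min (v r) ((max n₀ n₁ : ℕ) : ℝ≥0∞)) N L
        + 2⁻¹ * fracDispersion 2 L p * cellOccupation N L (planeWaveMode L p) Ψ.ψ)
        + ENNReal.ofReal ε := add_right_comm _ _ _
    _ ≤ (periodicEnergy (fun r => min (v r) ((max n₀ n₁ : ℕ) : ℝ≥0∞)) Ψ + B) + ENNReal.ofReal ε :=
        add_le_add h2 le_rfl
    _ ≤ (periodicEnergy v Ψ + B) + ε := by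
        rw [hεeq]; exact add_le_add (add_le_add h3 le_rfl) le_rfl

/-- **Tower SMS ⇒ SMS, per potential (thermodynamic form).** For every admissible `v`: height-uniform SMS along the
truncation tower (constant `C`, density window `ρ₀`, level threshold depending on `(N, p)`) implies SMS for `v` with the
same constant on the window `ρ < min ρ₀ ρ₁`, `ρ₁` = Ruelle's finiteness threshold (`E₀^per(v; N, L_N) < ⊤` eventually).
[cite: LSSY2005, §1.2 (1.17)–(1.18)] -/
theorem sms_of_towerSMS (v : ℝ → ℝ≥0∞) (hv : IsRepulsiveFiniteRange v)
    (hT : ∃ C : ℝ, 0 < C ∧ ∃ ρ₀ : ℝ, 0 < ρ₀ ∧ ∀ ρ : ℝ, 0 < ρ → ρ < ρ₀ →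
        ∀ᶠ N : ℕ in atTop, ∀ p : Fin 3 → ℤ, p ≠ 0 → ∃ n₀ : ℕ, ∀ n : ℕ, n₀ ≤ n →
          ∀ Ψ : PeriodicTrialState N (sideLength ρ N),
            periodicGroundStateEnergy (fun r => min (v r) (n : ℝ≥0∞)) N (sideLength ρ N)
                + 2⁻¹ * fracDispersion 2 (sideLength ρ N) p
                  * cellOccupation N (sideLength ρ N) (planeWaveMode (sideLength ρ N) p) Ψ.ψ
              ≤ periodicEnergy (fun r => min (v r) (n : ℝ≥0∞)) Ψ + ENNReal.ofReal (C * ρ)) :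
    ∃ C : ℝ, 0 < C ∧ ∃ ρ₀ : ℝ, 0 < ρ₀ ∧ ∀ ρ : ℝ, 0 < ρ → ρ < ρ₀ →
        ∀ᶠ N : ℕ in atTop, ∀ p : Fin 3 → ℤ, p ≠ 0 →
          ∀ Ψ : PeriodicTrialState N (sideLength ρ N),
            periodicGroundStateEnergy v N (sideLength ρ N)
                + 2⁻¹ * fracDispersion 2 (sideLength ρ N) p
                  * cellOccupation N (sideLength ρ N) (planeWaveMode (sideLength ρ N) p) Ψ.ψ
              ≤ periodicEnergy v Ψ + ENNReal.ofReal (C * ρ) := by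
  obtain ⟨C, hC, ρ₀, hρ₀, hmain⟩ := hT
  obtain ⟨ρ₁, hρ₁, hfinv⟩ :=
    Literature.Barriers.AtomisticToContinuum.BoseGas.exists_eventually_periodicGroundStateEnergy_lt_top hv
  refine ⟨C, hC, min ρ₀ ρ₁, lt_min hρ₀ hρ₁, fun ρ hρ hρlt => ?_⟩
  have hρ0 : ρ < ρ₀ := hρlt.trans_le (min_le_left _ _)
  have hρ1 : ρ < ρ₁ := hρlt.trans_le (min_le_right _ _)
  filter_upwards [hmain ρ hρ hρ0, eventually_gt_atTop 0, hfinv ρ hρ hρ1] with N hN hN0 hEN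
  intro p hp
  obtain ⟨n₀, hn₀⟩ := hN p hp
  exact modePriceAt_of_towerSMS hv (sideLength_pos_of_pos hρ hN0) hEN.ne p _ hn₀

/-- **Stub `stub_smsHardCore_of_towerSMS` (the line's composition lemma, registered).** Height-uniform tower SMS for
the non-integrable admissible potentials ⇒ the body of `ModePriceHardCore` (literally the route decl, unfolded). [cite: LSSY2005, §1.2 (1.17)–(1.18)] -/
theorem stub_smsHardCore_of_towerSMS :
    (∀ v : ℝ → ℝ≥0∞, IsRepulsiveFiniteRange v → (∫⁻ x : Space, v ‖x‖) = ⊤ →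
      ∃ C : ℝ, 0 < C ∧ ∃ ρ₀ : ℝ, 0 < ρ₀ ∧ ∀ ρ : ℝ, 0 < ρ → ρ < ρ₀ →
        ∀ᶠ N : ℕ in atTop, ∀ p : Fin 3 → ℤ, p ≠ 0 → ∃ n₀ : ℕ, ∀ n : ℕ, n₀ ≤ n →
          ∀ Ψ : PeriodicTrialState N (sideLength ρ N),
            periodicGroundStateEnergy (fun r => min (v r) (n : ℝ≥0∞)) N (sideLength ρ N)
                + 2⁻¹ * fracDispersion 2 (sideLength ρ N) p
                  * cellOccupation N (sideLength ρ N) (planeWaveMode (sideLength ρ N) p) Ψ.ψ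
              ≤ periodicEnergy (fun r => min (v r) (n : ℝ≥0∞)) Ψ + ENNReal.ofReal (C * ρ)) →
    ∀ v : ℝ → ℝ≥0∞, IsRepulsiveFiniteRange v → (∫⁻ x : Space, v ‖x‖) = ⊤ →
      ∃ C : ℝ, 0 < C ∧ ∃ ρ₀ : ℝ, 0 < ρ₀ ∧ ∀ ρ : ℝ, 0 < ρ → ρ < ρ₀ →
        ∀ᶠ N : ℕ in atTop, ∀ p : Fin 3 → ℤ, p ≠ 0 →
          ∀ Ψ : PeriodicTrialState N (sideLength ρ N),
            periodicGroundStateEnergy v N (sideLength ρ N)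
                + 2⁻¹ * fracDispersion 2 (sideLength ρ N) p
                  * cellOccupation N (sideLength ρ N) (planeWaveMode (sideLength ρ N) p) Ψ.ψ
              ≤ periodicEnergy v Ψ + ENNReal.ofReal (C * ρ) :=
  fun hT v hv hint => sms_of_towerSMS v hv (hT v hv hint)

/-! ## Equivalences -/

/-- **SMS(v) ⟺ tower SMS(v), for every admissible `v`** (integrable or not; constants may change: `←` keeps `C` and
shrinks the density window, `→` doubles `C` — the landed necessity stub `stub_uniformTower_of_modePrice`).
[cite: ReedSimonIV1978, Thm XIII.64] -/
theorem sms_iff_towerSMS (v : ℝ → ℝ≥0∞) (hv : IsRepulsiveFiniteRange v) :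
    (∃ C : ℝ, 0 < C ∧ ∃ ρ₀ : ℝ, 0 < ρ₀ ∧ ∀ ρ : ℝ, 0 < ρ → ρ < ρ₀ →
        ∀ᶠ N : ℕ in atTop, ∀ p : Fin 3 → ℤ, p ≠ 0 →
          ∀ Ψ : PeriodicTrialState N (sideLength ρ N),
            periodicGroundStateEnergy v N (sideLength ρ N)
                + 2⁻¹ * fracDispersion 2 (sideLength ρ N) p
                  * cellOccupation N (sideLength ρ N) (planeWaveMode (sideLength ρ N) p) Ψ.ψ
              ≤ periodicEnergy v Ψ + ENNReal.ofReal (C * ρ)) ↔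
    (∃ C : ℝ, 0 < C ∧ ∃ ρ₀ : ℝ, 0 < ρ₀ ∧ ∀ ρ : ℝ, 0 < ρ → ρ < ρ₀ →
        ∀ᶠ N : ℕ in atTop, ∀ p : Fin 3 → ℤ, p ≠ 0 → ∃ n₀ : ℕ, ∀ n : ℕ, n₀ ≤ n →
          ∀ Ψ : PeriodicTrialState N (sideLength ρ N),
            periodicGroundStateEnergy (fun r => min (v r) (n : ℝ≥0∞)) N (sideLength ρ N)
                + 2⁻¹ * fracDispersion 2 (sideLength ρ N) p
                  * cellOccupation N (sideLength ρ N) (planeWaveMode (sideLength ρ N) p) Ψ.ψ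
              ≤ periodicEnergy (fun r => min (v r) (n : ℝ≥0∞)) Ψ + ENNReal.ofReal (C * ρ)) :=
  ⟨stub_uniformTower_of_modePrice v hv, sms_of_towerSMS v hv⟩

/-- **The line's residue is EQUIVALENT to the crux**: height-uniform SMS along the truncation towers of the non-integrable
admissible potentials ⟺ `ModePriceHardCore`. So the tower shadow smuggles in no strength: the crux IS the statement that
the integrable single-mode price survives the limit `‖min(v,n)‖₁ → ∞` at fixed scattering length. [cite: LSSY2005, Ch. 2 p. 14] -/
theorem towerSMS_iff_modePriceHardCore :
    (∀ v : ℝ → ℝ≥0∞, IsRepulsiveFiniteRange v → (∫⁻ x : Space, v ‖x‖) = ⊤ →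
      ∃ C : ℝ, 0 < C ∧ ∃ ρ₀ : ℝ, 0 < ρ₀ ∧ ∀ ρ : ℝ, 0 < ρ → ρ < ρ₀ →
        ∀ᶠ N : ℕ in atTop, ∀ p : Fin 3 → ℤ, p ≠ 0 → ∃ n₀ : ℕ, ∀ n : ℕ, n₀ ≤ n →
          ∀ Ψ : PeriodicTrialState N (sideLength ρ N),
            periodicGroundStateEnergy (fun r => min (v r) (n : ℝ≥0∞)) N (sideLength ρ N)
                + 2⁻¹ * fracDispersion 2 (sideLength ρ N) p
                  * cellOccupation N (sideLength ρ N) (planeWaveMode (sideLength ρ N) p) Ψ.ψ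
              ≤ periodicEnergy (fun r => min (v r) (n : ℝ≥0∞)) Ψ + ENNReal.ofReal (C * ρ)) ↔
    ModePriceHardCore :=
  ⟨fun hT => stub_smsHardCore_of_towerSMS hT,
    fun h v hv hint => stub_uniformTower_of_modePrice v hv (h v hv hint)⟩

/-! ## The crux from scale-free integrable SMS -/

/-- **`ModePriceHardCore` ⟸ scale-free integrable SMS.** If the single-mode softening price is `≤ Cρ` for all INTEGRABLE
repulsive finite-range potentials of range `≤ R₀` with `(C, ρ₀, N₀)` depending on `R₀` only, then it holds for every
non-integrable admissible potential (hard cores, strongly singular cores): instantiate at the integrable levels `min(v,n)`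
(`stub_uniformTower_of_scaleFree`) and take the shadow (`stub_smsHardCore_of_towerSMS`). This is the precise sense in
which the hard-core crux is the renormalisation audit (`‖v‖₁ ↦ a(v) ≤ R₀`) of the integrable crux `ModePriceIntegrable`.
[cite: LSSY2005, Ch. 2 p. 14] -/
theorem modePriceHardCore_of_scaleFree
    (hSF : ∀ R₀ : ℝ, 0 < R₀ → ∃ C : ℝ, 0 < C ∧ ∃ ρ₀ : ℝ, 0 < ρ₀ ∧ ∀ ρ : ℝ, 0 < ρ → ρ < ρ₀ →
      ∃ N₀ : ℕ, ∀ N : ℕ, N₀ ≤ N → ∀ p : Fin 3 → ℤ, p ≠ 0 →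
        ∀ v : ℝ → ℝ≥0∞, IsRepulsiveFiniteRange v → (∀ r, R₀ < r → v r = 0) →
          (∫⁻ x : Space, v ‖x‖) ≠ ⊤ →
          ∀ Ψ : PeriodicTrialState N (sideLength ρ N),
            periodicGroundStateEnergy v N (sideLength ρ N)
                + 2⁻¹ * fracDispersion 2 (sideLength ρ N) p
                  * cellOccupation N (sideLength ρ N) (planeWaveMode (sideLength ρ N) p) Ψ.ψ
              ≤ periodicEnergy v Ψ + ENNReal.ofReal (C * ρ)) :
    ModePriceHardCore :=
  stub_smsHardCore_of_towerSMS (stub_uniformTower_of_scaleFree hSF)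

/-! ## One scale-free statement for both price cruxes (appended, lead cycle 1) -/

/-- **`ModePriceIntegrable` ⟸ scale-free integrable SMS** (instantiation at the range of `v`): the integrable crux of the
route (stmt-AtomisticToContinuum-18512) is the `v`-pointwise form of the scale-free statement. [cite: LSSY2005, Ch. 2 p. 14] -/
theorem modePriceIntegrable_of_scaleFree
    (hSF : ∀ R₀ : ℝ, 0 < R₀ → ∃ C : ℝ, 0 < C ∧ ∃ ρ₀ : ℝ, 0 < ρ₀ ∧ ∀ ρ : ℝ, 0 < ρ → ρ < ρ₀ →
      ∃ N₀ : ℕ, ∀ N : ℕ, N₀ ≤ N → ∀ p : Fin 3 → ℤ, p ≠ 0 →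
        ∀ v : ℝ → ℝ≥0∞, IsRepulsiveFiniteRange v → (∀ r, R₀ < r → v r = 0) →
          (∫⁻ x : Space, v ‖x‖) ≠ ⊤ →
          ∀ Ψ : PeriodicTrialState N (sideLength ρ N),
            periodicGroundStateEnergy v N (sideLength ρ N)
                + 2⁻¹ * fracDispersion 2 (sideLength ρ N) p
                  * cellOccupation N (sideLength ρ N) (planeWaveMode (sideLength ρ N) p) Ψ.ψ
              ≤ periodicEnergy v Ψ + ENNReal.ofReal (C * ρ)) :
    ModePriceIntegrable := by
  intro v hv hint
  obtain ⟨R₀, hR₀⟩ := hv.2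
  obtain ⟨C, hC, ρ₀, hρ₀, h⟩ := hSF (max R₀ 1) (lt_of_lt_of_le one_pos (le_max_right _ _))
  refine ⟨C, hC, ρ₀, hρ₀, fun ρ hρ hρ0 => ?_⟩
  obtain ⟨N₀, hN₀⟩ := h ρ hρ hρ0
  filter_upwards [eventually_ge_atTop N₀] with N hN
  intro p hp Ψ
  exact hN₀ N hN p hp v hv (fun r hr => hR₀ r (lt_of_le_of_lt (le_max_left _ _) hr)) hint Ψ

/-- **Both price cruxes of route BECModePrice from ONE scale-free statement**: SMS for integrable finite-range potentials
with range-only constants implies `ModePriceIntegrable ∧ ModePriceHardCore` (the route's `X`), the hard-core half through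
the truncation tower. [cite: LSSY2005, Ch. 2 p. 14] -/
theorem modePrice_both_of_scaleFree :
    (∀ R₀ : ℝ, 0 < R₀ → ∃ C : ℝ, 0 < C ∧ ∃ ρ₀ : ℝ, 0 < ρ₀ ∧ ∀ ρ : ℝ, 0 < ρ → ρ < ρ₀ →
      ∃ N₀ : ℕ, ∀ N : ℕ, N₀ ≤ N → ∀ p : Fin 3 → ℤ, p ≠ 0 →
        ∀ v : ℝ → ℝ≥0∞, IsRepulsiveFiniteRange v → (∀ r, R₀ < r → v r = 0) →
          (∫⁻ x : Space, v ‖x‖) ≠ ⊤ →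
          ∀ Ψ : PeriodicTrialState N (sideLength ρ N),
            periodicGroundStateEnergy v N (sideLength ρ N)
                + 2⁻¹ * fracDispersion 2 (sideLength ρ N) p
                  * cellOccupation N (sideLength ρ N) (planeWaveMode (sideLength ρ N) p) Ψ.ψ
              ≤ periodicEnergy v Ψ + ENNReal.ofReal (C * ρ)) →
    ModePriceIntegrable ∧ ModePriceHardCore :=
  fun hSF => ⟨modePriceIntegrable_of_scaleFree hSF, modePriceHardCore_of_scaleFree hSF⟩

/-! ## The other checked line (`Sketch`, idea monotone-truncation-transfer) has the same open residue (appended) -/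

/-- **Level-uniform truncation SMS ⟸ scale-free integrable SMS.** The transfer hypothesis `TruncationUniformSMS` of the
second checked line of this crux (`Sketch`, idea `monotone-truncation-transfer`: SMS along `min(v,n)` for ALL levels `n`
inside one `N`-eventuality) is an instance family of the scale-free integrable statement, exactly like the tower form
(`stub_uniformTower_of_scaleFree`). [cite: LSSY2005, Ch. 2 p. 14] -/
theorem truncationUniformSMS_of_scaleFree
    (hSF : ∀ R₀ : ℝ, 0 < R₀ → ∃ C : ℝ, 0 < C ∧ ∃ ρ₀ : ℝ, 0 < ρ₀ ∧ ∀ ρ : ℝ, 0 < ρ → ρ < ρ₀ →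
      ∃ N₀ : ℕ, ∀ N : ℕ, N₀ ≤ N → ∀ p : Fin 3 → ℤ, p ≠ 0 →
        ∀ v : ℝ → ℝ≥0∞, IsRepulsiveFiniteRange v → (∀ r, R₀ < r → v r = 0) →
          (∫⁻ x : Space, v ‖x‖) ≠ ⊤ →
          ∀ Ψ : PeriodicTrialState N (sideLength ρ N),
            periodicGroundStateEnergy v N (sideLength ρ N)
                + 2⁻¹ * fracDispersion 2 (sideLength ρ N) p
                  * cellOccupation N (sideLength ρ N) (planeWaveMode (sideLength ρ N) p) Ψ.ψ
              ≤ periodicEnergy v Ψ + ENNReal.ofReal (C * ρ)) :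
    ∀ v : ℝ → ℝ≥0∞, IsRepulsiveFiniteRange v → (∫⁻ x : Space, v ‖x‖) = ⊤ →
      ∃ C : ℝ, 0 < C ∧ ∃ ρ₀ : ℝ, 0 < ρ₀ ∧ ∀ ρ : ℝ, 0 < ρ → ρ < ρ₀ →
        ∀ᶠ N : ℕ in atTop, ∀ n : ℕ, ∀ p : Fin 3 → ℤ, p ≠ 0 →
          ∀ Ψ : PeriodicTrialState N (sideLength ρ N),
            periodicGroundStateEnergy (fun r => min (v r) (n : ℝ≥0∞)) N (sideLength ρ N)
                + 2⁻¹ * fracDispersion 2 (sideLength ρ N) p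
                  * cellOccupation N (sideLength ρ N) (planeWaveMode (sideLength ρ N) p) Ψ.ψ
              ≤ periodicEnergy (fun r => min (v r) (n : ℝ≥0∞)) Ψ + ENNReal.ofReal (C * ρ) := by
  intro v hv _
  obtain ⟨R₀, hR₀⟩ := hv.2
  have hR₁ : ∀ r, max R₀ 1 < r → v r = 0 := fun r hr => hR₀ r (lt_of_le_of_lt (le_max_left _ _) hr)
  obtain ⟨C, hC, ρ₀, hρ₀, h⟩ := hSF (max R₀ 1) (lt_of_lt_of_le one_pos (le_max_right _ _))
  refine ⟨C, hC, ρ₀, hρ₀, fun ρ hρ hρ0 => ?_⟩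
  obtain ⟨N₀, hN₀⟩ := h ρ hρ hρ0
  filter_upwards [eventually_ge_atTop N₀] with N hN
  intro n p hp Ψ
  exact hN₀ N hN p hp (fun r => min (v r) (n : ℝ≥0∞)) (isRepulsiveFiniteRange_min_const hv n)
    (fun r hr => by simp [hR₁ r hr]) (lintegral_min_const_norm_ne_top hR₁ n) Ψ

/-- **Level-uniform truncation SMS ⇒ height-uniform tower SMS** (take the level threshold `n₀ = 0`). [cite: LSSY2005, Ch. 2 p. 14] -/
theorem towerSMS_of_truncationUniformSMS
    (hTU : ∀ v : ℝ → ℝ≥0∞, IsRepulsiveFiniteRange v → (∫⁻ x : Space, v ‖x‖) = ⊤ →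
      ∃ C : ℝ, 0 < C ∧ ∃ ρ₀ : ℝ, 0 < ρ₀ ∧ ∀ ρ : ℝ, 0 < ρ → ρ < ρ₀ →
        ∀ᶠ N : ℕ in atTop, ∀ n : ℕ, ∀ p : Fin 3 → ℤ, p ≠ 0 →
          ∀ Ψ : PeriodicTrialState N (sideLength ρ N),
            periodicGroundStateEnergy (fun r => min (v r) (n : ℝ≥0∞)) N (sideLength ρ N)
                + 2⁻¹ * fracDispersion 2 (sideLength ρ N) p
                  * cellOccupation N (sideLength ρ N) (planeWaveMode (sideLength ρ N) p) Ψ.ψ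
              ≤ periodicEnergy (fun r => min (v r) (n : ℝ≥0∞)) Ψ + ENNReal.ofReal (C * ρ)) :
    ∀ v : ℝ → ℝ≥0∞, IsRepulsiveFiniteRange v → (∫⁻ x : Space, v ‖x‖) = ⊤ →
      ∃ C : ℝ, 0 < C ∧ ∃ ρ₀ : ℝ, 0 < ρ₀ ∧ ∀ ρ : ℝ, 0 < ρ → ρ < ρ₀ →
        ∀ᶠ N : ℕ in atTop, ∀ p : Fin 3 → ℤ, p ≠ 0 → ∃ n₀ : ℕ, ∀ n : ℕ, n₀ ≤ n →
          ∀ Ψ : PeriodicTrialState N (sideLength ρ N),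
            periodicGroundStateEnergy (fun r => min (v r) (n : ℝ≥0∞)) N (sideLength ρ N)
                + 2⁻¹ * fracDispersion 2 (sideLength ρ N) p
                  * cellOccupation N (sideLength ρ N) (planeWaveMode (sideLength ρ N) p) Ψ.ψ
              ≤ periodicEnergy (fun r => min (v r) (n : ℝ≥0∞)) Ψ + ENNReal.ofReal (C * ρ) := by
  intro v hv hint
  obtain ⟨C, hC, ρ₀, hρ₀, h⟩ := hTU v hv hint
  refine ⟨C, hC, ρ₀, hρ₀, fun ρ hρ hρ0 => ?_⟩
  filter_upwards [h ρ hρ hρ0] with N hN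
  exact fun p hp => ⟨0, fun n _ Ψ => hN n p hp Ψ⟩

/-- **The `Sketch` line's composition, kernel-checked** (registered sub-goal): level-uniform truncation SMS ⇒
`ModePriceHardCore`. With `truncationUniformSMS_of_scaleFree` and `towerSMS_iff_modePriceHardCore` the residues of the two
checked lines are sandwiched: scale-free integrable SMS ⇒ `TruncationUniformSMS` ⇒ tower SMS ⟺ crux — both lines wait on
the same open statement. [cite: LSSY2005, Ch. 2 p. 14] -/
theorem modePriceHardCore_of_truncationUniformSMS :
    (∀ v : ℝ → ℝ≥0∞, IsRepulsiveFiniteRange v → (∫⁻ x : Space, v ‖x‖) = ⊤ →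
      ∃ C : ℝ, 0 < C ∧ ∃ ρ₀ : ℝ, 0 < ρ₀ ∧ ∀ ρ : ℝ, 0 < ρ → ρ < ρ₀ →
        ∀ᶠ N : ℕ in atTop, ∀ n : ℕ, ∀ p : Fin 3 → ℤ, p ≠ 0 →
          ∀ Ψ : PeriodicTrialState N (sideLength ρ N),
            periodicGroundStateEnergy (fun r => min (v r) (n : ℝ≥0∞)) N (sideLength ρ N)
                + 2⁻¹ * fracDispersion 2 (sideLength ρ N) p
                  * cellOccupation N (sideLength ρ N) (planeWaveMode (sideLength ρ N) p) Ψ.ψ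
              ≤ periodicEnergy (fun r => min (v r) (n : ℝ≥0∞)) Ψ + ENNReal.ofReal (C * ρ)) →
    ModePriceHardCore :=
  fun hTU => stub_smsHardCore_of_towerSMS (towerSMS_of_truncationUniformSMS hTU)

end Summit.AtomisticToContinuum.BoseEinsteinCondensation.Cruxes.ModePriceHardCore.TowerShadow

end
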